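import Literature.NumberTheory.LFunctions.WeilFirstPrimeOddMarginDataD
import Literature.NumberTheory.LFunctions.WeilFirstPrimeCertificateCKappa
import HarnessLib

/-!
# Odd-sector margin certificate D: the value of `κ` and the scalar side conditions

Part of the check of `weilCertOddD` (`WeilFirstPrimeOddMarginDataD.lean`) — `a₀`, `N`, `T`, level, cells and tolerances are those of `weilCert3C`, so `κ` is LITERALLY `weilCert3C.kappaQ` (definitional unfolding, no kernel evaluation). Pure proof file; nothing is asserted.
-/

noncomputable section

namespace Literature.NumberTheory.LFunctions


/-- **The value of `κ`** of the odd-sector margin certificate D. [folklore] -/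
theorem kappaQ_weilCertOddD : weilCertOddD.kappaQ = (23264065549356049135287148592400665151/21267647932558653966460912964485513216 : ℚ) :=
  kappaQ_weilCert3C

/-- The margin is positive and below `κ`: `0 ≤ κ' ≤ κ` for certificate D (`κ − κ' = 138017886645630860717094787844671/21267647932558653966460912964485513216 ≈ 6.4896e-06`). [folklore] -/
theorem kappa'_nonneg_le_weilCertOddD : 0 ≤ weilCertOddDKappa' ∧ weilCertOddDKappa' ≤ weilCertOddD.kappaQ := by
  rw [kappaQ_weilCertOddD]; unfold weilCertOddDKappa'; norm_num

set_option maxHeartbeats 0 in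
/-- **Kernel check of the scalar side conditions** of certificate D (`0 < b ≤ a₀ ≤ 1`, `2a₀T ≤ N+2`, Taylor remainder, `κ ≥ 0`), with `κ` rewritten to its value first. [folklore] -/
theorem checkScalars_weilCertOddD : weilCertOddD.checkScalars = true := by
  have h : weilCertOddD.checkScalars = (decide (1 ≤ weilCertOddD.j) && decide (0 < weilCertOddD.b) && decide (weilCertOddD.b ≤ weilCertOddD.base.a0) &&
      decide (weilCertOddD.base.a0 ≤ 1) && decide (0 < weilCertOddD.base.T) && decide (2 * weilCertOddD.base.a0 * weilCertOddD.base.T ≤ (weilCertOddD.base.N : ℚ) + 2) &&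
      decide (2 * (weilCertOddD.base.a0 * weilCertOddD.base.T) ^ (weilCertOddD.base.N + 1) / (weilCertOddD.base.N + 1).factorial ≤ 1) &&
      decide (weilCertOddD.base.N + 1 = 2 * weilCertOddD.base.nb) && decide (0 ≤ weilCertOddD.kappaQ)) := rfl
  rw [h, kappaQ_weilCertOddD]
  decide +kernel

end Literature.NumberTheory.LFunctions
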